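import Summits.HodgeConjecture.CorCM.MumfordTateRankFiveConverse
import Literature.AlgebraicGeometry.Motives.MumfordTateLieAlgebraEqHodgeLie
import HarnessLib

/-!
# `dim MT(H¹X) = dim_ℚ Lie Hg(H¹X) + 1` for every complex abelian variety of positive dimension; the rung `dim MT(H¹X) = 5`,
# `X` not of CM type, read on the Mumford–Tate group: `dim MT(H¹X) = 5 ⟺ X ∼ B^{a+1} × E^{b+1}`

COR-CM (cell `pub-hodgecm2`, seat `b27` gen 35, count-neutral; theorems only, no definition, no named fact; UNCONDITIONAL —
nothing here uses or asserts HC_CM).  The Literature theorem `HodgeStructure.mtRank_eq_finrank_hodgeLie_add_one`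
(`Motives/MumfordTateLieAlgebraEqHodgeLie`, gen 35: `𝔪𝔱 = 𝔥 ⊕ ℚ·id` for a polarizable Hodge structure of nonzero weight, the
Lie-algebra form of `MT = 𝔾ₘ · Hg`) specialised to `H¹` of a complex abelian variety (weight `1`, polarized by the Riemann form),
and the ladder files `CorCM/MumfordTateRankFive*` re-read on `dim MT` instead of `dim Lie Hg`:

* **`mtRank_hodge_one_eq_finrank_hodgeLie_add_one`** — `dim MT(H¹X) = dim_ℚ Lie Hg(H¹X) + 1` (`0 < dim X`).
* **`mtRank_hodge_one_eq_five_iff`** — for `X` NOT of CM type: `dim MT(H¹X) = 5` IFF along the isotypic decomposition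
  `X ∼ ⨁ₗ Bₗ^{nₗ+1}` there are exactly two components, `Bᵢ` simple non-CM with `dim End⁰(Bᵢ) = (dim Bᵢ)²`, `dim Bᵢ ≤ 2`, and
  `Bⱼ` a CM elliptic curve (gen 33's theorem and gen 35's converse, `finrank_hodgeLie_hodge_one_eq_four_iff`);
  `mtRank_hodge_one_eq_five_of_isIsogenous_two_powers` — the converse read on `dim MT`.
* `exists_isIsogenous_power_of_mtRank_hodge_one_eq_four` — the rung `t = 4` non-CM read on `dim MT = 4` exactly.

## References
* [MoonenZarhin1999LowDim] B. Moonen, Yu. Zarhin, Math. Ann. 315 (1999), §2 («`MT = 𝔾ₘ · Hg`», (2.1)–(2.5)) and §3.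
* [Deligne1982HodgeCycles] P. Deligne, *Hodge cycles on abelian varieties*, LNM 900 (1982), I Prop. 3.4, Prop. 3.6.
* [MumfordAV1970] D. Mumford, *Abelian Varieties* (1970), §19–§20 (the Riemann form).
-/

noncomputable section

open CategoryTheory CategoryTheory.Limits Module
open scoped BigOperators

namespace Summit.HodgeConjecture.CorCM

open Literature.AlgebraicGeometry.Motives
open Literature.AlgebraicGeometry.Motives.AbelianVariety
open Literature.AlgebraicGeometry.Motives.HodgeStructure
open Literature.AlgebraicGeometry.HodgeTheory
open Literature.AlgebraicGeometry.Milne1999 (IsOfCMType)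

variable [HodgeTensorFacts.{0, 0}] {X : AbelianVariety ℂ} {n : ℕ}

/-- **`dim MT(H¹X) = dim_ℚ Lie Hg(H¹X) + 1` for every complex abelian variety `X` of positive dimension**: `H¹(X(ℂ); ℚ)` is a
polarizable Hodge structure of weight `1 ≠ 0` (Riemann form, `BettiUniverse.hodge_isPolarizable`), so
`𝔪𝔱(H¹X) = Lie Hg(H¹X) ⊕ ℚ·id` (`HodgeStructure.mtRank_eq_finrank_hodgeLie_add_one`; Moonen–Zarhin §2: `MT(X) = 𝔾ₘ · Hg(X)`).
[cite: MoonenZarhin1999LowDim, §2] [cite: Deligne1982HodgeCycles, I Prop. 3.4 and Prop. 3.6] -/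
theorem mtRank_hodge_one_eq_finrank_hodgeLie_add_one (hX : IsSmoothProjective n X.X) (h0 : 0 < X.dim) :
    haveI := BettiUniverse.finite hX 1
    (BettiUniverse.hodge exists_isReal_hodgeModel_holds hX 1).mtRank =
      Module.finrank ℚ (BettiUniverse.hodge exists_isReal_hodgeModel_holds hX 1).hodgeLie + 1 := by
  have hn : X.dim = n := schemeDim_eq_holds hX
  subst hn
  haveI := BettiUniverse.finite hX 1
  haveI : Nontrivial (bettiCohomology X.X 1) := nontrivial_bettiCohomology_one h0
  obtain ⟨ψ⟩ := BettiUniverse.hodge_isPolarizable exists_isReal_hodgeModel_holds hX 1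
  exact HodgeStructure.mtRank_eq_finrank_hodgeLie_add_one _ ψ (by simp)

/-- **`dim_ℚ Lie Hg(H¹X) = k ⟺ dim MT(H¹X) = k + 1`** (`0 < dim X`). [cite: MoonenZarhin1999LowDim, §2] -/
theorem finrank_hodgeLie_hodge_one_eq_iff_mtRank_eq (hX : IsSmoothProjective n X.X) (h0 : 0 < X.dim) (k : ℕ) :
    haveI := BettiUniverse.finite hX 1
    Module.finrank ℚ (BettiUniverse.hodge exists_isReal_hodgeModel_holds hX 1).hodgeLie = k ↔
      (BettiUniverse.hodge exists_isReal_hodgeModel_holds hX 1).mtRank = k + 1 := by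
  have h := mtRank_hodge_one_eq_finrank_hodgeLie_add_one hX h0
  constructor
  · intro hk; rw [h, hk]
  · intro hk; rw [h] at hk; omega

/-- **The converse of the rung `dim MT(H¹X) = 5`, read on the Mumford–Tate group**: `X ∼ ⨁ₗ Bₗ^{nₗ+1}` with exactly two
isotypic components, `Bᵢ` simple NOT of CM type with `dim End⁰(Bᵢ) = (dim Bᵢ)²`, `dim Bᵢ ≤ 2`, `Bⱼ` a CM elliptic curve ⟹
`dim MT(H¹X) = 5` (`finrank_hodgeLie_hodge_one_eq_four_of_isIsogenous_two_powers` and `dim MT = dim Lie Hg + 1`).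
[cite: MoonenZarhin1999LowDim, §2 (2.1)–(2.5) and §3] [cite: Deligne1982HodgeCycles, I Prop. 3.4] -/
theorem mtRank_hodge_one_eq_five_of_isIsogenous_two_powers (hX : IsSmoothProjective n X.X)
    {r : ℕ} {B : Fin r → AbelianVariety ℂ} {nB : Fin r → ℕ} {i j : Fin r}
    (hS : ∀ l, (B l).IsSimple) (hd : ∀ l, 0 < (B l).dim) (hni : ∀ l l', l ≠ l' → ¬ IsIsogenous (B l) (B l'))
    (hXB : IsIsogenous X (⨁ fun l => ⨁ fun _ : Fin (nB l + 1) => B l)) (hij : i ≠ j) (hall : ∀ l, l = i ∨ l = j)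
    (hcmi : ¬ IsOfCMType (B i)) (hEi : Module.finrank ℚ (B i).endAlgebra = (B i).dim ^ 2) (hdimi : (B i).dim ≤ 2)
    (hdj1 : (B j).dim = 1) (hcmj : IsOfCMType (B j)) :
    haveI := BettiUniverse.finite hX 1
    (BettiUniverse.hodge exists_isReal_hodgeModel_holds hX 1).mtRank = 5 := by
  have h0 : 0 < X.dim := by
    obtain ⟨f, hf⟩ := hXB
    rw [dim_eq_of_isIsogeny hf, AndreRiemann.dim_biproduct_fin]
    refine Finset.sum_pos' (fun l _ => Nat.zero_le _) ⟨i, Finset.mem_univ _, ?_⟩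
    rw [AndreRiemann.dim_biproduct_const]
    exact Nat.mul_pos (Nat.succ_pos _) (hd i)
  exact (finrank_hodgeLie_hodge_one_eq_iff_mtRank_eq hX h0 4).1
    (finrank_hodgeLie_hodge_one_eq_four_of_isIsogenous_two_powers hX hS hd hni hXB hij hall hcmi hEi hdimi hdj1 hcmj)

/-- **The rung `dim MT(H¹X) = 5` for `X` NOT of CM type is an iff** (Moonen–Zarhin §2, the class `MT = 𝔾ₘ · SL₂ · U(1)` up to
isogeny): `dim MT(H¹X) = 5` if and only if the isotypic decomposition of `X` has exactly two components, a simple non-CM `Bᵢ`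
with `dim End⁰(Bᵢ) = (dim Bᵢ)²`, `dim Bᵢ ≤ 2` (non-CM elliptic curve or QM abelian surface) and a CM elliptic curve `Bⱼ` —
`finrank_hodgeLie_hodge_one_eq_four_iff` read through `dim MT = dim Lie Hg + 1`.
[cite: MoonenZarhin1999LowDim, §2 (2.1)–(2.5) and §3] [cite: MumfordAV1970, §19 Thm. 1 Cor. 1–2 and p. 174] -/
theorem mtRank_hodge_one_eq_five_iff (hX : IsSmoothProjective n X.X) (h0 : 0 < X.dim) (hcm : ¬ IsOfCMType X) :
    haveI := BettiUniverse.finite hX 1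
    (BettiUniverse.hodge exists_isReal_hodgeModel_holds hX 1).mtRank = 5 ↔
      ∃ (r : ℕ) (B : Fin r → AbelianVariety ℂ) (nB : Fin r → ℕ) (i j : Fin r),
        (∀ l, (B l).IsSimple) ∧ (∀ l, 0 < (B l).dim) ∧ (∀ l l', l ≠ l' → ¬ IsIsogenous (B l) (B l')) ∧
        IsIsogenous X (⨁ fun l => ⨁ fun _ : Fin (nB l + 1) => B l) ∧
        i ≠ j ∧ (∀ l, l = i ∨ l = j) ∧
        ¬ IsOfCMType (B i) ∧ Module.finrank ℚ (B i).endAlgebra = (B i).dim ^ 2 ∧ (B i).dim ≤ 2 ∧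
        (B j).dim = 1 ∧ Module.finrank ℚ (B j).endAlgebra = 2 ∧ IsOfCMType (B j) := by
  rw [← finrank_hodgeLie_hodge_one_eq_iff_mtRank_eq hX h0 4]
  exact finrank_hodgeLie_hodge_one_eq_four_iff hX hcm

/-- **`dim MT(H¹X) = 4 ⟺ dim_ℚ Lie Hg(H¹X) = 3`** and then, for `X` NOT of CM type, `X ∼ B^{m+1}` with `B` simple non-CM,
`dim End⁰(B) = (dim B)²` (`exists_isIsogenous_power_of_finrank_hodgeLie_le_three`, `CorCM/MumfordTateRankFiveCenter`) — the rung
`t = 4` of the ladder read either way. [cite: MoonenZarhin1999LowDim, §2] -/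
theorem exists_isIsogenous_power_of_mtRank_hodge_one_eq_four (hX : IsSmoothProjective n X.X) (h0 : 0 < X.dim)
    (hcm : ¬ IsOfCMType X)
    (h4 : haveI := BettiUniverse.finite hX 1
      (BettiUniverse.hodge exists_isReal_hodgeModel_holds hX 1).mtRank = 4) :
    ∃ (B : AbelianVariety ℂ) (m : ℕ), B.IsSimple ∧ 0 < B.dim ∧ ¬ IsOfCMType B ∧
      IsIsogenous X (⨁ fun _ : Fin (m + 1) => B) ∧ X.dim = (m + 1) * B.dim ∧
      Module.finrank ℚ B.endAlgebra = B.dim ^ 2 ∧ Module.finrank ℚ (Subalgebra.center ℚ B.endAlgebra) = 1 :=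
  exists_isIsogenous_power_of_finrank_hodgeLie_le_three hX h0 hcm
    (le_of_eq ((finrank_hodgeLie_hodge_one_eq_iff_mtRank_eq hX h0 3).2 h4))

end Summit.HodgeConjecture.CorCM

end
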